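import Mathlib
import HarnessLib
import Summits.NavierStokesRegularity.NavierStokesRegularity.Theorems.WakeRatchetMinimalViscousBlowupViscosityBootstrap
import Summits.NavierStokesRegularity.NavierStokesRegularity.Theorems.WakeRatchetMinimalViscousBlowupClosedValve

/-!
# Route `WakeRatchet`, crux `MinimalViscousBlowup` (stmt-NavierStokesRegularity-22743) — LINE g11-1 «threshold ray» (ns-idea-1 g11),
# stub S3b-β `stub_thresholdContinuity`: CONTINUITY AT THE THRESHOLD FROM ABOVE

`thresholdContinuity` (binders VERBATIM from the skeleton of record v3.2 416f5fca5e78a209 = v3.3 7006732859c348a5): along a `ν`-trajectory `X` on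
`[0,T)` that is (4.5)-regular on every `[0,T']`, the supercriticality levels `λⁿ‖X_n(t₀)‖²` at a fixed time `t₀ < T` are bounded, uniformly in
the shell `n`, by those of the global regular solutions at viscosities `ν' ↓ ν` plus any `η > 0`.  This is (E2) of STUB-PLAN-regularOpen: on the
window `[0,(t₀+T)/2]` the landed `weighted_continuity` (Grönwall in the weight `λ^{8k⁺}` + continuous-induction bootstrap) gives
`λ^{8k⁺}|X' − X| ≤ η'` once `ν' − ν < δ`, and `λᵏ(‖X_k‖² − ‖X'_k‖²) ≤ λᵏ‖X_k − X'_k‖(2‖X_k‖ + ‖X_k − X'_k‖) ≤ (8M+4)η'`.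
MODEL lattice ODEs only; nothing here concerns the Navier–Stokes equations (no NS regularity statement is proved).
`--supports stmt-NavierStokesRegularity-22743 --as helper`.
[cite: Teschl2012, Thm. 2.8 (dependence on parameters); Tao2016AveragedNS, §4 Lemma 4.1 (4.5)]
-/

noncomputable section

-- the summit and its single sub-problem share the name (CONVENTIONS §1)
set_option linter.dupNamespace false

open Set Filter Topology

namespace Summit.NavierStokesRegularity.NavierStokesRegularity.Theorems.MinimalViscousBlowup.ThresholdRay

open Literature.Analysis.FluidPDE Literature.Analysis.FluidPDE.TaoCascade

/-- Componentwise bound ⇒ Euclidean bound for `m = 4`: `|w_i| ≤ b` for all `i` gives `‖w‖ ≤ 2b` for a shell vector. [folklore] -/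
theorem norm_shellVec_le_two_mul {X : Fin 4 → ℤ → ℝ → ℝ} {k : ℤ} {t b : ℝ} (hb : 0 ≤ b)
    (h : ∀ i, |X i k t| ≤ b) : ‖shellVec X k t‖ ≤ 2 * b := by
  have hsq : ‖shellVec X k t‖ ^ 2 ≤ (2 * b) ^ 2 := by
    rw [norm_shellVec_sq]
    calc ∑ i : Fin 4, X i k t ^ 2 ≤ ∑ _i : Fin 4, b ^ 2 :=
          Finset.sum_le_sum fun i _ => by rw [← sq_abs]; exact pow_le_pow_left₀ (abs_nonneg _) (h i) 2
      _ = (2 * b) ^ 2 := by simp; ring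
  exact (pow_le_pow_iff_left₀ (norm_nonneg _) (by positivity) two_ne_zero).1 hsq

/-- **S3b-β `stub_thresholdContinuity` (LINE g11-1 v3.2/v3.3, binders VERBATIM) — CONTINUITY AT THE THRESHOLD FROM ABOVE.**  For a table of the
class `E₂(R)`, `ν > 0` and a `ν`-trajectory `X` on `[0,T)` from a one-shell datum ((4.5)-regular on every `[0,T']`): for every `t₀ < T` and
`η > 0` there is `δ > 0` such that every global regular `ν'`-solution `X'`, `ν < ν' < ν + δ`, satisfies
`λⁿ‖X_n(t₀)‖² ≤ λⁿ‖X'_n(t₀)‖² + η` for every shell `n`.  MODEL lattice only.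
[cite: Teschl2012, Thm. 2.8; Tao2016AveragedNS, §4 Lemma 4.1 (4.5)] -/
theorem thresholdContinuity : ∀ ε₀ : ℝ, 0 < ε₀ → ∀ R : ℝ, 1 ≤ R →
    ∀ (α : Fin 4 → Fin 4 → Fin 4 → ℤ × ℤ × ℤ → ℝ) (X₀ : Fin 4 → ℝ),
    Literature.Analysis.FluidPDE.TaoCascade.InTableClass R α →
    ∀ ν : ℝ, 0 < ν →
    ∀ (T : ℝ) (X : Fin 4 → ℤ → ℝ → ℝ), 0 < T →
    (∀ i n, ContDiffOn ℝ 1 (X i n) (Set.Ico 0 T)) →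
    (∀ i n, X i n 0 = if n = 0 then X₀ i else 0) →
    (∀ i n t, n < 0 → X i n t = 0) →
    (∀ i n t, 0 ≤ t → t < T → derivWithin (X i n) (Set.Ici 0) t =
      Literature.Analysis.FluidPDE.TaoCascade.quadTerm ε₀ α X i n t - ν * (1 + ε₀) ^ ((2 : ℝ) * n) * X i n t) →
    (∀ T' : ℝ, 0 < T' → T' < T → ∃ M : ℝ, ∀ t : ℝ, 0 ≤ t → t ≤ T' →
      ∀ (i : Fin 4) (n : ℤ), (1 + (1 + ε₀) ^ ((10 : ℝ) * n)) * |X i n t| ≤ M) →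
    ∀ t₀ : ℝ, 0 ≤ t₀ → t₀ < T → ∀ η : ℝ, 0 < η → ∃ δ : ℝ, 0 < δ ∧
      ∀ ν' : ℝ, ν < ν' → ν' < ν + δ → ∀ X' : Fin 4 → ℤ → ℝ → ℝ,
        Literature.Analysis.FluidPDE.TaoCascade.ViscousGlobal ε₀ ν' α X₀ X' →
        ∀ n : ℤ, (1 + ε₀) ^ n * ‖Literature.Analysis.FluidPDE.TaoCascade.shellVec X n t₀‖ ^ 2 ≤
          (1 + ε₀) ^ n * ‖Literature.Analysis.FluidPDE.TaoCascade.shellVec X' n t₀‖ ^ 2 + η := by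
  intro ε₀ hε R _hR α X₀ hα ν hν T X hT hcd hinit hlow hmot hreg t₀ ht₀ ht₀T η hη
  have hl0 : (0 : ℝ) < 1 + ε₀ := by linarith
  have hl1 : (1 : ℝ) ≤ 1 + ε₀ := by linarith
  -- the window `[0, T']`
  set T' : ℝ := (t₀ + T) / 2 with hT'
  have hT'0 : 0 < T' := by rw [hT']; linarith
  have ht₀T' : t₀ ≤ T' := by rw [hT']; linarith
  have hT'T : T' < T := by rw [hT']; linarith
  obtain ⟨M₀, hM₀⟩ := hreg T' hT'0 hT'T
  set M : ℝ := max M₀ 0 with hMdef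
  have hM0 : 0 ≤ M := le_max_right _ _
  have hM : ∀ t ∈ Icc (0 : ℝ) T', ∀ (i : Fin 4) (k : ℤ), (1 + (1 + ε₀) ^ ((10 : ℝ) * k)) * |X i k t| ≤ M :=
    fun t ht i k => (hM₀ t ht.1 ht.2 i k).trans (le_max_left _ _)
  -- the restricted table is bounded by `1` and drives the same nonlinearity
  have hα' : ∀ i₁ i₂ i₃ μ, |restrictShiftSet α i₁ i₂ i₃ μ| ≤ 1 :=
    abs_restrictShiftSet_le zero_le_one (abs_le_one_of_inTableClass hα)
  -- `X` solves the lattice within the window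
  have hXd : ∀ (i : Fin 4) (k : ℤ), ∀ t ∈ Icc 0 T', HasDerivWithinAt (X i k)
      (quadTerm ε₀ (restrictShiftSet α) X i k t - ν * (1 + ε₀) ^ ((2 : ℝ) * k) * X i k t) (Icc 0 T') t := by
    intro i k t ht
    have htT : t < T := lt_of_le_of_lt ht.2 hT'T
    have htI : t ∈ Ico (0 : ℝ) T := ⟨ht.1, htT⟩
    have hd := ((hcd i k).differentiableOn one_ne_zero t htI).hasDerivWithinAt
    have hset : Ico (0 : ℝ) T = Ici 0 ∩ Iio T := Ici_inter_Iio.symm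
    have heq : derivWithin (X i k) (Ico 0 T) t = derivWithin (X i k) (Ici 0) t := by
      rw [hset, derivWithin_inter (Iio_mem_nhds htT)]
    rw [heq, hmot i k t ht.1 htT, ← quadTerm_restrictShiftSet] at hd
    exact hd.mono fun u hu => ⟨hu.1, lt_of_le_of_lt hu.2 hT'T⟩
  -- the closeness target, the Grönwall constant and `δ`
  set η' : ℝ := min 1 (η / (8 * M + 8)) with hη'
  have hη'0 : 0 < η' := by rw [hη']; positivity
  have hη'1 : η' ≤ 1 := min_le_left _ _
  have hη'le : (8 * M + 8) * η' ≤ η := by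
    have h := min_le_right 1 (η / (8 * M + 8))
    rw [← hη'] at h
    rwa [le_div_iff₀ (by positivity), mul_comm] at h
  set Cg : ℝ := 2 ^ (⌈T' * (16 * ((4 : ℕ) : ℝ) ^ 2 * 1 * (1 + ε₀) ^ (10 : ℝ) * (M + 2) + 1)⌉₊ + 1) * M with hCg
  have hCg0 : 0 ≤ Cg := by rw [hCg]; positivity
  set δ : ℝ := η' / (Cg + 1) with hδ
  have hδ0 : 0 < δ := by rw [hδ]; positivity
  refine ⟨δ, hδ0, fun ν' hνν' hν'δ X' hX' n => ?_⟩
  have hν'0 : 0 ≤ ν' := by linarith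
  have hsmall : Cg * |ν' - ν| ≤ η' := by
    rw [abs_of_pos (by linarith)]
    have h1 : ν' - ν ≤ η' / (Cg + 1) := by rw [← hδ]; linarith
    calc Cg * (ν' - ν) ≤ Cg * (η' / (Cg + 1)) := mul_le_mul_of_nonneg_left h1 hCg0
      _ = η' * (Cg / (Cg + 1)) := by ring
      _ ≤ η' * 1 := by
          refine mul_le_mul_of_nonneg_left ?_ hη'0.le
          rw [div_le_one (by positivity)]
          linarith
      _ = η' := mul_one _
  -- `X'` solves the lattice within the window
  have hYd : ∀ (i : Fin 4) (k : ℤ), ∀ t ∈ Icc 0 T', HasDerivWithinAt (X' i k)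
      (quadTerm ε₀ (restrictShiftSet α) X' i k t - ν' * (1 + ε₀) ^ ((2 : ℝ) * k) * X' i k t) (Icc 0 T') t := by
    intro i k t ht
    have h := ((hX'.contDiffOn i k).differentiableOn one_ne_zero t (show t ∈ Ici (0 : ℝ) from ht.1)).hasDerivWithinAt
    rw [hX'.motion i k t ht.1, ← quadTerm_restrictShiftSet] at h
    exact h.mono fun u hu => hu.1
  obtain ⟨M', hM'⟩ := hX'.apriori T' hT'0
  -- (E2) on the window
  have hD := weighted_continuity (m := 4) (S := T') hε zero_le_one hα' hν'0 hM0 hη'0 hη'1 le_rfl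
    (fun i k => by rw [hinit, hX'.init]) (fun i k hk t _ => hlow i k t hk) (fun i k hk t ht => hX'.noLow i k t hk ht.1)
    hM ⟨M', fun t ht i k => hM' t ht i k⟩ hXd hYd hsmall
  have ht₀w : t₀ ∈ Icc (0 : ℝ) T' := ⟨ht₀, ht₀T'⟩
  rcases lt_or_ge n 0 with hn | hn
  · -- below the datum shell both sides vanish
    have h0 : shellVec X n t₀ = 0 := by
      ext j
      simp [shellVec_apply, hlow j n t₀ hn]
    rw [h0, norm_zero]
    have : 0 ≤ (1 + ε₀) ^ n * ‖shellVec X' n t₀‖ ^ 2 := mul_nonneg (zpow_nonneg hl0.le _) (sq_nonneg _)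
    nlinarith [zpow_nonneg hl0.le n]
  · obtain ⟨k, rfl⟩ := Int.eq_ofNat_of_zero_le hn
    rw [zpow_natCast]
    set P : ℝ := (1 + ε₀) ^ k with hP
    have hP0 : 0 < P := pow_pos hl0 k
    have hP1 : 1 ≤ P := one_le_pow₀ hl1
    -- componentwise: `|X| ≤ M/P`, `|X − X'| ≤ η'/P`
    have hXk : ∀ i : Fin 4, |X i k t₀| ≤ M / P := by
      intro i
      have h := hM t₀ ht₀w i k
      have hw : (1 + ε₀) ^ ((10 : ℝ) * ((k : ℕ) : ℤ)) = P ^ 10 := by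
        rw [show ((10 : ℝ) * (((k : ℕ) : ℤ) : ℝ)) = ((k * 10 : ℕ) : ℝ) by push_cast; ring, Real.rpow_natCast, pow_mul]
      rw [hw] at h
      have hP10 : P ≤ P ^ 10 := le_self_pow₀ hP1 (by norm_num)
      rw [le_div_iff₀ hP0]
      nlinarith [abs_nonneg (X i k t₀)]
    have hDk : ∀ i : Fin 4, |X i k t₀ - X' i k t₀| ≤ η' / P := by
      intro i
      have h := hD t₀ ht₀w i k
      rw [max_eq_left (by positivity : (0 : ℤ) ≤ (k : ℤ))] at h
      have hw : (1 + ε₀) ^ ((8 : ℝ) * (((k : ℕ) : ℤ) : ℝ)) = P ^ 8 := by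
        rw [show ((8 : ℝ) * (((k : ℕ) : ℤ) : ℝ)) = ((k * 8 : ℕ) : ℝ) by push_cast; ring, Real.rpow_natCast, pow_mul]
      rw [hw, abs_sub_comm] at h
      have hP8 : P ≤ P ^ 8 := le_self_pow₀ hP1 (by norm_num)
      rw [le_div_iff₀ hP0]
      nlinarith [abs_nonneg (X i k t₀ - X' i k t₀)]
    -- Euclidean: `‖u‖ ≤ 2M/P`, `‖u − v‖ ≤ 2η'/P`
    set u := shellVec X (k : ℤ) t₀ with hu
    set v := shellVec X' (k : ℤ) t₀ with hv
    have hnu : ‖u‖ ≤ 2 * (M / P) := norm_shellVec_le_two_mul (by positivity) hXk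
    have hud : u - v = shellVec (fun i n t => X i n t - X' i n t) (k : ℤ) t₀ := by
      ext j
      simp [hu, hv, shellVec_apply]
    have hnd : ‖u - v‖ ≤ 2 * (η' / P) := by
      rw [hud]
      exact norm_shellVec_le_two_mul (by positivity) hDk
    -- `‖u‖² − ‖v‖² ≤ ‖u − v‖ (2‖u‖ + ‖u − v‖)`
    have h1 : ‖u‖ - ‖v‖ ≤ ‖u - v‖ := norm_sub_norm_le u v
    have h2 : ‖v‖ ≤ ‖u‖ + ‖u - v‖ := by
      have := norm_sub_le u (u - v)
      rwa [sub_sub_cancel] at this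
    have h3 : ‖u‖ ^ 2 - ‖v‖ ^ 2 ≤ ‖u - v‖ * (2 * ‖u‖ + ‖u - v‖) := by
      nlinarith [mul_nonneg (sub_nonneg.2 h1) (add_nonneg (norm_nonneg u) (norm_nonneg v)),
        mul_nonneg (norm_nonneg (u - v)) (sub_nonneg.2 h2)]
    have h4 : ‖u - v‖ * (2 * ‖u‖ + ‖u - v‖) ≤ (2 * (η' / P)) * (4 * (M / P) + 2 * (η' / P)) :=
      mul_le_mul hnd (by linarith) (by positivity) (by positivity)
    have h5 : P * ((2 * (η' / P)) * (4 * (M / P) + 2 * (η' / P))) = (8 * M * η' + 4 * η' ^ 2) / P := by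
      field_simp
      ring
    have h6 : (8 * M * η' + 4 * η' ^ 2) / P ≤ 8 * M * η' + 4 * η' ^ 2 := div_le_self (by positivity) hP1
    have h7 : η' ^ 2 ≤ η' := by
      have := mul_le_mul_of_nonneg_left hη'1 hη'0.le
      rwa [mul_one, ← sq] at this
    have h8 := mul_le_mul_of_nonneg_left (h3.trans h4) hP0.le
    rw [h5] at h8
    linarith [h8, h6, h7, hη'le, hη'0.le, hM0]

/-- Alias under the skeleton's stub name (LINE g11-1 v3.2/v3.3 `stub_thresholdContinuity`). [folklore] -/
theorem stub_thresholdContinuity : ∀ ε₀ : ℝ, 0 < ε₀ → ∀ R : ℝ, 1 ≤ R →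
    ∀ (α : Fin 4 → Fin 4 → Fin 4 → ℤ × ℤ × ℤ → ℝ) (X₀ : Fin 4 → ℝ),
    Literature.Analysis.FluidPDE.TaoCascade.InTableClass R α →
    ∀ ν : ℝ, 0 < ν →
    ∀ (T : ℝ) (X : Fin 4 → ℤ → ℝ → ℝ), 0 < T →
    (∀ i n, ContDiffOn ℝ 1 (X i n) (Set.Ico 0 T)) →
    (∀ i n, X i n 0 = if n = 0 then X₀ i else 0) →
    (∀ i n t, n < 0 → X i n t = 0) →
    (∀ i n t, 0 ≤ t → t < T → derivWithin (X i n) (Set.Ici 0) t =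
      Literature.Analysis.FluidPDE.TaoCascade.quadTerm ε₀ α X i n t - ν * (1 + ε₀) ^ ((2 : ℝ) * n) * X i n t) →
    (∀ T' : ℝ, 0 < T' → T' < T → ∃ M : ℝ, ∀ t : ℝ, 0 ≤ t → t ≤ T' →
      ∀ (i : Fin 4) (n : ℤ), (1 + (1 + ε₀) ^ ((10 : ℝ) * n)) * |X i n t| ≤ M) →
    ∀ t₀ : ℝ, 0 ≤ t₀ → t₀ < T → ∀ η : ℝ, 0 < η → ∃ δ : ℝ, 0 < δ ∧
      ∀ ν' : ℝ, ν < ν' → ν' < ν + δ → ∀ X' : Fin 4 → ℤ → ℝ → ℝ,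
        Literature.Analysis.FluidPDE.TaoCascade.ViscousGlobal ε₀ ν' α X₀ X' →
        ∀ n : ℤ, (1 + ε₀) ^ n * ‖Literature.Analysis.FluidPDE.TaoCascade.shellVec X n t₀‖ ^ 2 ≤
          (1 + ε₀) ^ n * ‖Literature.Analysis.FluidPDE.TaoCascade.shellVec X' n t₀‖ ^ 2 + η :=
  thresholdContinuity

end Summit.NavierStokesRegularity.NavierStokesRegularity.Theorems.MinimalViscousBlowup.ThresholdRay

end
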